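import Mathlib
import Summits.Ventures.PercRepro2.HCov
import Summits.Ventures.PercRepro2.BHKAvoid
import Summits.Ventures.PercRepro2.BHKEvents
import Summits.Ventures.PercRepro2.CrossClusterFunctional
import Summits.Ventures.PercRepro2.RootLeafUHalf
import Summits.Ventures.PercRepro2.RootLeafUMixK
import Summits.Ventures.PercRepro2.RootLeafUMixKA
import Summits.Ventures.PercRepro2.RootLeafUMixHb
import Summits.Ventures.PercRepro2.RootLeafUMixHbThm
import Summits.Ventures.PercRepro2.RootLeafUKMaster
import Summits.Ventures.PercRepro2.RootLeafUKSide

/-!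
# The `o ∈ K` half of the second root-leaf coefficient: `K3 ≥ 0` whenever `A ≥ 2β·M` for ANY constant `M`
dominating the residual connection `g(L) = P_{G ∖ L}(a₂ ↔ b)` on the clusters `L = C(u) ∋ c`
(blind cell PercRepro2, p4 g27; S3 (G4-u) item (ap))

`F1_nonneg` (RootLeafUKSide, p4 g25) proves `0 ≤ hb·δK + (b)` by the functional BHK06 Thm 1.4 for the antitone
`φ(L) = hb·1_{c∉L} + g(L)·1_{c∈L}`; its only use of `hb = P(a₂ ↔ b)` is the bound `g(L) ≤ hb` that makes `φ` antitone
when `c` enters `L`.  The same proof runs with ANY constant `M ≥ g(L)` for every cluster `L = C(u)(ω)` containing `c`: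

* `bhk_cross_functional_avoid_clusterAnti`: BHK06 Thm 1.4 in functional form with set avoidance, the functional of
  `C_t` only assumed antitone ALONG NESTED CLUSTERS of `t` (`cluster ends ω t ⊆ cluster ends ω' t →
  Ψ (cluster ends ω' t) ≤ Ψ (cluster ends ω t)`) — the proof of `bhk_cross_functional_avoid` verbatim;
* `phiM_clusterAnti`, `phiM_mul_R_eq`, `oK_phiM_mul_R_eq`: `φ_M(L) = M·1_{c∉L} + g(L)·1_{c∈L}` under the hypothesis
  `hM : ∀ ω, c ∈ C(u)(ω) → g(C(u)(ω)) ≤ M`;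
* **`F1M_nonneg`**: `0 ≤ M·δK + (b)` for every such `M ≥ 0` — hence **`K3_nonneg_of_A_ge_M`** / **`T2oK_nonneg_of_A_ge_M`**:
  `2β·M ≤ A → 0 ≤ K3 := A·δK + 2β·(b) → 0 ≤ T2oK` (through `KSide.T2oK_nonneg_of_K3`);
* the two constants in the tree's vocabulary: `M = hb` recovers `KSide.T2oK_nonneg_of_A_ge`, and
  **`T2oK_nonneg_of_A_ge_guc`** takes `M = g({u, c}) = P_{G − {u, c}}(a₂ ↔ b)` (`delClusterProb` at `{u, c}`), valid since
  every cluster `C(u) ∋ c` contains `{u, c}` and `g` is antitone (`delClusterProb_anti`).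

The class `A ≥ 2β·M` with `M = sup{g(C(u)(ω)) : c ∈ C(u)(ω)}` strictly contains the class `A ≥ 2β·hb` of `T2oK_nonneg_of_A_ge`
(`M ≤ g({u, c}) ≤ hb`); on the census of this seat it covers ≈ 84 % of the random instances with `A < 2β·hb` (≈ 64 % with
`g({u, c})`), and all nine open-regime K4 counterexamples W7, W16–W24 of p4 g26 (where `K4 < 0` while `K3 > 0`): there `K3 ≥ 0`
is now a theorem.  The regime `A < 2β·M` stays open.  No definitions; standard axioms.
-/

namespace Summit.Ventures.PercRepro2

open UnionCluster CovForm

namespace RootLeafU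

namespace KSup

variable {V : Type*} {E : Type*} [Fintype E] [DecidableEq E] [Fintype V] [DecidableEq V]
  {R : Type*} [Field R] [LinearOrder R] [IsStrictOrderedRing R]

section ClusterAnti

variable (p : E → R) (ends : E → Sym2 V)

omit [Fintype V] [DecidableEq V] in
/-- `W ↦ E[Ψ(C_t) in G ∖ W]` is monotone when `Ψ` is antitone along nested clusters of `t`. -/
lemma delExpect_clusterFn_mono_of_clusterAnti (hp : IsProbVec p) (t : V) {Ψ : Set V → R}
    (hΨ : ∀ ω ω' : Config E, cluster ends ω t ⊆ cluster ends ω' t →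
      Ψ (cluster ends ω' t) ≤ Ψ (cluster ends ω t)) :
    Monotone (delExpect p ends (fun t ω => Ψ (cluster ends ω t)) t) := by
  intro W W' h
  rw [delExpect_clusterFn_apply, delExpect_clusterFn_apply]
  unfold expect
  refine Finset.sum_le_sum fun ω _ => ?_
  refine mul_le_mul_of_nonneg_left ?_ (weight_nonneg hp ω)
  exact hΨ _ _ (cluster_mono (delConfig_anti h ω) t)

/-- **BHK06 Thm 1.4, functional form with set avoidance, for a functional of `C_t` antitone along nested
clusters** (`X ∋ t`): `E[F₁(C_s) 1_{s↮X}] · E[Ψ(C_t) 1_{s↮X}] ≤ E[F₁(C_s) Ψ(C_t) 1_{s↮X}] · P(s ↮ X)`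
(the proof of `bhk_cross_functional_avoid`, with `delExpect_clusterFn_mono_of_clusterAnti`). -/
theorem bhk_cross_functional_avoid_clusterAnti (hp : IsProbVec p) (s t : V)
    {X : Finset V} (ht : t ∈ X) {F₁ Ψ : Set V → R} (hF₁ : Monotone F₁) (hF₁0 : ∀ S, 0 ≤ F₁ S)
    (hΨ : ∀ ω ω' : Config E, cluster ends ω t ⊆ cluster ends ω' t →
      Ψ (cluster ends ω' t) ≤ Ψ (cluster ends ω t))
    (hΨ0 : ∀ S, 0 ≤ Ψ S) :
    expect p (fun ω => F₁ (cluster ends ω s) * (avoidAll ends s X).indicator 1 ω) *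
        expect p (fun ω => Ψ (cluster ends ω t) * (avoidAll ends s X).indicator 1 ω) ≤
      expect p (fun ω => F₁ (cluster ends ω s) * Ψ (cluster ends ω t) *
          (avoidAll ends s X).indicator 1 ω) * prob p (avoidAll ends s X) := by
  classical
  set G := delExpect p ends (fun t ω => Ψ (cluster ends ω t)) t with hG
  have hGmono : Monotone G := delExpect_clusterFn_mono_of_clusterAnti p ends hp t hΨ
  have hG0 : ∀ W, 0 ≤ G W := delExpect_clusterFn_nonneg p hp ends t hΨ0
  have key := bhk_induced p hp ends s hF₁ hGmono hF₁0 hG0 Finset.univ X X (Finset.subset_univ _)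
    (Finset.subset_univ _)
  simp only [Finset.inter_self, Finset.union_self, REvent_univ] at key
  have e : ∀ F : Set V → R, clusterObs ends Finset.univ s F * (avoidAll ends s X).indicator 1 =
      fun ω => F (cluster ends ω s) * (avoidAll ends s X).indicator 1 ω := by
    intro F
    funext ω
    simp only [Pi.mul_apply, clusterObs_apply, clusterIn_univ]
  rw [e, e, e] at key
  simp only [Pi.mul_apply] at key
  have t1 := expect_cross_avoid_eq p ends s t ht (fun _ => (1 : R)) Ψ
  have t2 := expect_cross_avoid_eq p ends s t ht F₁ Ψ
  simp only [one_mul] at t1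
  rw [t1, t2]
  exact key

end ClusterAnti

section PhiM

variable (p : E → R) (ends : E → Sym2 V) (o a₂ c b u : V) (M : R)

omit [Fintype V] [DecidableEq V] in
/-- **`φ_M` is antitone along nested clusters of `u`**: `φ_M(L) = g(L)` if `c ∈ L`, `M` if `c ∉ L`, under
`hM : g(C(u)(ω)) ≤ M` for every configuration with `c ∈ C(u)(ω)`. -/
lemma phiM_clusterAnti (hp : IsProbVec p)
    (hM : ∀ ω : Config E, c ∈ cluster ends ω u →
      delClusterProb p ends a₂ {W : Set V | b ∈ W} (cluster ends ω u) ≤ M) :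
    ∀ ω ω' : Config E, cluster ends ω u ⊆ cluster ends ω' u →
      (({W : Set V | c ∈ W}).indicator (delClusterProb p ends a₂ {W : Set V | b ∈ W}) (cluster ends ω' u) +
        ({W : Set V | c ∉ W}).indicator (fun _ => M) (cluster ends ω' u)) ≤
      (({W : Set V | c ∈ W}).indicator (delClusterProb p ends a₂ {W : Set V | b ∈ W}) (cluster ends ω u) +
        ({W : Set V | c ∉ W}).indicator (fun _ => M) (cluster ends ω u)) := by
  intro ω ω' h
  have hg := delClusterProb_anti p hp ends a₂ (𝓥 := {W : Set V | b ∈ W}) (fun _ _ h hb => h hb) h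
  by_cases hc : c ∈ cluster ends ω u
  · have hc' : c ∈ cluster ends ω' u := h hc
    rw [Set.indicator_of_mem (show cluster ends ω u ∈ {W : Set V | c ∈ W} from hc),
      Set.indicator_of_mem (show cluster ends ω' u ∈ {W : Set V | c ∈ W} from hc'),
      Set.indicator_of_notMem (show cluster ends ω u ∉ {W : Set V | c ∉ W} from fun h' => h' hc),
      Set.indicator_of_notMem (show cluster ends ω' u ∉ {W : Set V | c ∉ W} from fun h' => h' hc')]
    linarith
  · rw [Set.indicator_of_notMem (show cluster ends ω u ∉ {W : Set V | c ∈ W} from hc),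
      Set.indicator_of_mem (show cluster ends ω u ∈ {W : Set V | c ∉ W} from hc)]
    by_cases hc' : c ∈ cluster ends ω' u
    · rw [Set.indicator_of_mem (show cluster ends ω' u ∈ {W : Set V | c ∈ W} from hc'),
        Set.indicator_of_notMem (show cluster ends ω' u ∉ {W : Set V | c ∉ W} from fun h' => h' hc')]
      have := hM ω' hc'
      linarith
    · rw [Set.indicator_of_notMem (show cluster ends ω' u ∉ {W : Set V | c ∈ W} from hc'),
        Set.indicator_of_mem (show cluster ends ω' u ∈ {W : Set V | c ∉ W} from hc')]

omit [Fintype V] [DecidableEq V] in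
/-- `φ_M ≥ 0` when `M ≥ 0`. -/
lemma phiM_nonneg (hp : IsProbVec p) (hM0 : 0 ≤ M) (L : Set V) :
    0 ≤ ({W : Set V | c ∈ W}).indicator (delClusterProb p ends a₂ {W : Set V | b ∈ W}) L +
        ({W : Set V | c ∉ W}).indicator (fun _ => M) L := by
  refine add_nonneg (Set.indicator_apply_nonneg fun _ => ?_) (Set.indicator_apply_nonneg fun _ => hM0)
  exact delClusterProb_nonneg p hp ends a₂ _ L

omit [LinearOrder R] [IsStrictOrderedRing R] in
/-- **The splitting of `φ_M(L)·1_R`** (pointwise): `φ_M(C_u)·1_{a₂↮{u,c}} = 1_{c∈L}·g(L)·1_{u↮a₂} + M·1_{PD}`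
(`MixK.phi_mul_R_eq` with `M` in place of `hb`). -/
lemma phiM_mul_R_eq (ω : Config E) :
    (({W : Set V | c ∈ W}).indicator (delClusterProb p ends a₂ {W : Set V | b ∈ W}) (cluster ends ω u) +
        ({W : Set V | c ∉ W}).indicator (fun _ => M) (cluster ends ω u)) *
      (avoidAll ends a₂ {u, c}).indicator 1 ω =
    ({W : Set V | c ∈ W}).indicator (1 : Set V → R) (cluster ends ω u) *
        delClusterProb p ends a₂ {W : Set V | b ∈ W} (cluster ends ω u) *
        (avoidAll ends u {a₂}).indicator 1 ω +
      M * (PDEvent ends u a₂ c).indicator 1 ω := by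
  have hPD : PDEvent ends u a₂ c = avoidAll ends a₂ {u, c} ∩ (connEvent ends u c)ᶜ :=
    (MixK.N_inter_uc_compl_eq ends a₂ c u).symm
  by_cases hc : Conn ends ω u c
  · have h1 : cluster ends ω u ∈ {W : Set V | c ∈ W} := hc
    have h2 : cluster ends ω u ∉ {W : Set V | c ∉ W} := fun h => h hc
    have h3 : ω ∉ PDEvent ends u a₂ c := by
      rw [hPD]
      exact fun h => h.2 hc
    rw [Set.indicator_of_mem h1, Set.indicator_of_notMem h2, Set.indicator_of_mem h1,
      Set.indicator_of_notMem h3]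
    by_cases hR : ω ∈ avoidAll ends a₂ {u, c}
    · rw [Set.indicator_of_mem hR,
        Set.indicator_of_mem ((MixK.mem_R_iff_of_conn ends a₂ c u hc).1 hR)]
      simp
    · rw [Set.indicator_of_notMem hR,
        Set.indicator_of_notMem (fun h => hR ((MixK.mem_R_iff_of_conn ends a₂ c u hc).2 h))]
      simp
  · have h1 : cluster ends ω u ∉ {W : Set V | c ∈ W} := hc
    have h2 : cluster ends ω u ∈ {W : Set V | c ∉ W} := hc
    rw [Set.indicator_of_notMem h1, Set.indicator_of_mem h2, Set.indicator_of_notMem h1]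
    by_cases hR : ω ∈ avoidAll ends a₂ {u, c}
    · have h3 : ω ∈ PDEvent ends u a₂ c := by
        rw [hPD]
        exact ⟨hR, hc⟩
      rw [Set.indicator_of_mem hR, Set.indicator_of_mem h3]
      simp
    · have h3 : ω ∉ PDEvent ends u a₂ c := by
        rw [hPD]
        exact fun h => hR h.1
      rw [Set.indicator_of_notMem hR, Set.indicator_of_notMem h3]
      simp

omit [LinearOrder R] [IsStrictOrderedRing R] in
/-- **The splitting of `1_{o∈K}·φ_M(L)·1_R`** (pointwise; `MixK.oK_phi_mul_R_eq` with `M`). -/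
lemma oK_phiM_mul_R_eq (ω : Config E) :
    ({W : Set V | o ∈ W}).indicator (1 : Set V → R) (cluster ends ω a₂) *
      (({W : Set V | c ∈ W}).indicator (delClusterProb p ends a₂ {W : Set V | b ∈ W}) (cluster ends ω u) +
        ({W : Set V | c ∉ W}).indicator (fun _ => M) (cluster ends ω u)) *
      (avoidAll ends a₂ {u, c}).indicator 1 ω =
    ({W : Set V | c ∈ W}).indicator (1 : Set V → R) (cluster ends ω u) *
        delClusterProb p ends a₂ {W : Set V | b ∈ W} (cluster ends ω u) *
        (connEvent ends a₂ o).indicator 1 ω * (avoidAll ends u {a₂}).indicator 1 ω +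
      M * (PDEvent ends u a₂ c ∩ connEvent ends a₂ o).indicator 1 ω := by
  have h := phiM_mul_R_eq p ends a₂ c b u M ω
  rw [MixK.indicator_mem_cluster_eq ends a₂ o ω]
  have e : (PDEvent ends u a₂ c ∩ connEvent ends a₂ o).indicator (1 : Config E → R) ω =
      (PDEvent ends u a₂ c).indicator 1 ω * (connEvent ends a₂ o).indicator 1 ω := by
    by_cases h1 : ω ∈ PDEvent ends u a₂ c <;> by_cases h2 : ω ∈ connEvent ends a₂ o <;>
      simp [Set.indicator, h1, h2]
  rw [e]
  calc (connEvent ends a₂ o).indicator (1 : Config E → R) ω *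
        (({W : Set V | c ∈ W}).indicator (delClusterProb p ends a₂ {W : Set V | b ∈ W}) (cluster ends ω u) +
          ({W : Set V | c ∉ W}).indicator (fun _ => M) (cluster ends ω u)) *
        (avoidAll ends a₂ {u, c}).indicator 1 ω
      = (connEvent ends a₂ o).indicator (1 : Config E → R) ω *
        ((({W : Set V | c ∈ W}).indicator (delClusterProb p ends a₂ {W : Set V | b ∈ W}) (cluster ends ω u) +
          ({W : Set V | c ∉ W}).indicator (fun _ => M) (cluster ends ω u)) *
        (avoidAll ends a₂ {u, c}).indicator 1 ω) := by ring
    _ = _ := by rw [h]; ring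

/-- **`0 ≤ F1_M := M·δK + (b)`** for every constant `M ≥ 0` dominating `g(L) = P_{G∖L}(a₂ ↔ b)` on the clusters
`L = C(u) ∋ c`: under `P(· | a₂ ↮ {u, c})`, `Cov(1_{o∈K}, P(c ∈ L | K)·(1_{b∈K} − M)) ≥ 0` — the proof of
`KSide.F1_nonneg` with `φ_M` in place of `φ` (`J0_eq`, `J_le`, `bhk_cross_functional_avoid_clusterAnti`). -/
theorem F1M_nonneg (hp : IsProbVec p) (hM0 : 0 ≤ M)
    (hM : ∀ ω : Config E, c ∈ cluster ends ω u →
      delClusterProb p ends a₂ {W : Set V | b ∈ W} (cluster ends ω u) ≤ M) :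
    0 ≤ M * (prob p (TEvent ends a₂ u c) * prob p (PDEvent ends u a₂ c ∩ connEvent ends a₂ o) -
        prob p (PDEvent ends u a₂ c) * prob p (TEvent ends a₂ u c ∩ connEvent ends a₂ o)) +
      ((prob p (PDEvent ends u a₂ c) + prob p (TEvent ends a₂ u c)) *
          prob p (TEvent ends a₂ u c ∩ (connEvent ends a₂ o ∩ connEvent ends a₂ b)) -
        (prob p (PDEvent ends u a₂ c ∩ connEvent ends a₂ o) + prob p (TEvent ends a₂ u c ∩ connEvent ends a₂ o)) *
          prob p (TEvent ends a₂ u c ∩ connEvent ends a₂ b)) := by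
  classical
  have hφanti := phiM_clusterAnti p ends a₂ c b u M hp hM
  have hφ0 := phiM_nonneg p ends a₂ c b M hp hM0
  have hF₁ : Monotone (({W : Set V | o ∈ W}).indicator (1 : Set V → R)) :=
    monotone_indicator_one_of_isUpperSet (fun _ _ h ho => h ho)
  have hF₁0 : ∀ S, 0 ≤ ({W : Set V | o ∈ W}).indicator (1 : Set V → R) S :=
    fun S => Set.indicator_apply_nonneg fun _ => zero_le_one
  have hu : u ∈ ({u, c} : Finset V) := by simp
  have key := bhk_cross_functional_avoid_clusterAnti p ends hp a₂ u hu hF₁ hF₁0 hφanti hφ0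
  have e1 : expect p (fun ω => ({W : Set V | o ∈ W}).indicator (1 : Set V → R) (cluster ends ω a₂) *
      (avoidAll ends a₂ {u, c}).indicator 1 ω) =
      prob p (PDEvent ends u a₂ c ∩ connEvent ends a₂ o) +
        prob p (TEvent ends a₂ u c ∩ connEvent ends a₂ o) := by
    rw [← prob_clusterInEvent_inter_eq_expect, ExploreA3.clusterInEvent_mem_eq, Set.inter_comm,
      MixK.prob_N_inter p ends a₂ c u (connEvent ends a₂ o)]
  have e2 : prob p (avoidAll ends a₂ {u, c}) =
      prob p (PDEvent ends u a₂ c) + prob p (TEvent ends a₂ u c) := by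
    have h := MixK.prob_N_inter p ends a₂ c u Set.univ
    simpa only [Set.inter_univ] using h
  have e3 : expect p (fun ω =>
      (({W : Set V | c ∈ W}).indicator (delClusterProb p ends a₂ {W : Set V | b ∈ W}) (cluster ends ω u) +
        ({W : Set V | c ∉ W}).indicator (fun _ => M) (cluster ends ω u)) *
      (avoidAll ends a₂ {u, c}).indicator 1 ω) =
      prob p (TEvent ends a₂ u c ∩ connEvent ends a₂ b) +
        M * prob p (PDEvent ends u a₂ c) := by
    have e : (fun ω =>
        (({W : Set V | c ∈ W}).indicator (delClusterProb p ends a₂ {W : Set V | b ∈ W}) (cluster ends ω u) +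
          ({W : Set V | c ∉ W}).indicator (fun _ => M) (cluster ends ω u)) *
        (avoidAll ends a₂ {u, c}).indicator 1 ω) =
        fun ω => ({W : Set V | c ∈ W}).indicator (1 : Set V → R) (cluster ends ω u) *
          delClusterProb p ends a₂ {W : Set V | b ∈ W} (cluster ends ω u) *
          (avoidAll ends u {a₂}).indicator 1 ω +
        M * (PDEvent ends u a₂ c).indicator 1 ω :=
      funext fun ω => phiM_mul_R_eq p ends a₂ c b u M ω
    rw [e, MixK.expect_add_fun p (fun ω => ({W : Set V | c ∈ W}).indicator (1 : Set V → R) (cluster ends ω u) *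
          delClusterProb p ends a₂ {W : Set V | b ∈ W} (cluster ends ω u) *
          (avoidAll ends u {a₂}).indicator 1 ω)
        (fun ω => M * (PDEvent ends u a₂ c).indicator 1 ω),
      expect_const_mul, ← prob_eq_expect_indicator, MixK.J0_eq]
  have e4 : expect p (fun ω => ({W : Set V | o ∈ W}).indicator (1 : Set V → R) (cluster ends ω a₂) *
      (({W : Set V | c ∈ W}).indicator (delClusterProb p ends a₂ {W : Set V | b ∈ W}) (cluster ends ω u) +
        ({W : Set V | c ∉ W}).indicator (fun _ => M) (cluster ends ω u)) *
      (avoidAll ends a₂ {u, c}).indicator 1 ω) =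
      expect p (fun ω => ({W : Set V | c ∈ W}).indicator (1 : Set V → R) (cluster ends ω u) *
        delClusterProb p ends a₂ {W : Set V | b ∈ W} (cluster ends ω u) *
        (connEvent ends a₂ o).indicator 1 ω * (avoidAll ends u {a₂}).indicator 1 ω) +
        M * prob p (PDEvent ends u a₂ c ∩ connEvent ends a₂ o) := by
    have e : (fun ω => ({W : Set V | o ∈ W}).indicator (1 : Set V → R) (cluster ends ω a₂) *
        (({W : Set V | c ∈ W}).indicator (delClusterProb p ends a₂ {W : Set V | b ∈ W}) (cluster ends ω u) +
          ({W : Set V | c ∉ W}).indicator (fun _ => M) (cluster ends ω u)) *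
        (avoidAll ends a₂ {u, c}).indicator 1 ω) =
        fun ω => ({W : Set V | c ∈ W}).indicator (1 : Set V → R) (cluster ends ω u) *
          delClusterProb p ends a₂ {W : Set V | b ∈ W} (cluster ends ω u) *
          (connEvent ends a₂ o).indicator 1 ω * (avoidAll ends u {a₂}).indicator 1 ω +
        M * (PDEvent ends u a₂ c ∩ connEvent ends a₂ o).indicator 1 ω :=
      funext fun ω => oK_phiM_mul_R_eq p ends o a₂ c b u M ω
    rw [e, MixK.expect_add_fun p (fun ω => ({W : Set V | c ∈ W}).indicator (1 : Set V → R) (cluster ends ω u) *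
          delClusterProb p ends a₂ {W : Set V | b ∈ W} (cluster ends ω u) *
          (connEvent ends a₂ o).indicator 1 ω * (avoidAll ends u {a₂}).indicator 1 ω)
        (fun ω => M * (PDEvent ends u a₂ c ∩ connEvent ends a₂ o).indicator 1 ω),
      expect_const_mul, ← prob_eq_expect_indicator]
  rw [e1, e2, e3, e4] at key
  have hJ := MixK.J_le p ends o a₂ c b u hp
  have hP0 : 0 ≤ prob p (PDEvent ends u a₂ c) + prob p (TEvent ends a₂ u c) :=
    add_nonneg (prob_nonneg hp _) (prob_nonneg hp _)
  have key2 := mul_le_mul_of_nonneg_right (add_le_add_right hJ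
    (M * prob p (PDEvent ends u a₂ c ∩ connEvent ends a₂ o))) hP0
  nlinarith [key, key2]

/-- **`0 ≤ K3 := A·δK + 2β·(b)` whenever `2β·M ≤ A`** for a constant `M ≥ 0` dominating `g` on the clusters
`C(u) ∋ c`: `K3 = (A − 2β·M)·δK + 2β·F1_M`. -/
theorem K3_nonneg_of_A_ge_M (hp : IsProbVec p) (hM0 : 0 ≤ M)
    (hM : ∀ ω : Config E, c ∈ cluster ends ω u →
      delClusterProb p ends a₂ {W : Set V | b ∈ W} (cluster ends ω u) ≤ M)
    (hA : 2 * (prob p Set.univ * prob p (PDEvent ends u a₂ c) + prob p (avoidAll ends a₂ {c}) * prob p (avoidAll ends a₂ {u})) * M ≤ ((prob p (PDEvent ends u a₂ c) * prob p (connEvent ends a₂ b) + prob p (avoidAll ends a₂ {c}) * gap p ends u a₂ b) + (prob p Set.univ * EQb3 p ends u a₂ c b + prob p Set.univ * PDb p ends u a₂ c b + prob p (connEvent ends a₂ b) * EQ3 p ends u a₂ c + prob p (connEvent ends a₂ b) * prob p (avoidAll ends a₂ {u}) - (prob p Set.univ - prob p (avoidAll ends a₂ {c})) * gap p ends u a₂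 b))) :
    0 ≤ (((prob p (PDEvent ends u a₂ c) * prob p (connEvent ends a₂ b) + prob p (avoidAll ends a₂ {c}) * gap p ends u a₂ b) + (prob p Set.univ * EQb3 p ends u a₂ c b + prob p Set.univ * PDb p ends u a₂ c b + prob p (connEvent ends a₂ b) * EQ3 p ends u a₂ c + prob p (connEvent ends a₂ b) * prob p (avoidAll ends a₂ {u}) - (prob p Set.univ - prob p (avoidAll ends a₂ {c})) * gap p ends u a₂ b)) * (prob p (TEvent ends a₂ u c) * prob p (PDEvent ends u a₂ c ∩ connEvent ends a₂ o) - prob p (PDEvent ends u a₂ c) * prob p (TEvent ends a₂ u c ∩ connEvent ends a₂ o)) + 2 * (prob p Set.univ * prob p (PDEvent ends u a₂ c) + prob p (avoidAll ends a₂ {c}) * prob p (avoidAll ends a₂ {u})) * ((prob p (PDEvent ends u a₂ c) + prob p (TEvent ends a₂ u c)) * prob p (TEvent ends a₂ u c ∩ (connEvent ends a₂ o ∩ connEvent ends a₂ b)) - (prob p (PDEvent ends u a₂ c ∩ connEvent ends a₂ o) + prob p (TEvent ends a₂ u c ∩ connEvent ends a₂ o)) * prob p (TEvent ends a₂ u c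 ∩ connEvent ends a₂ b))) := by
  classical
  have hF := F1M_nonneg p ends o a₂ c b u M hp hM0 hM
  have hδ := KMaster.deltaK_nonneg p ends o a₂ c u hp
  have n_d0 := prob_nonneg hp (avoidAll ends a₂ {c})
  have n_Z := prob_nonneg hp (avoidAll ends a₂ {u})
  have n_D := prob_nonneg hp (PDEvent ends u a₂ c)
  have n_β : 0 ≤ (prob p Set.univ * prob p (PDEvent ends u a₂ c) + prob p (avoidAll ends a₂ {c}) * prob p (avoidAll ends a₂ {u})) := by
    rw [prob_univ]
    nlinarith [mul_nonneg n_d0 n_Z]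
  nlinarith [mul_nonneg (sub_nonneg.2 hA) hδ, mul_nonneg n_β hF]

/-- **`0 ≤ T2oK` whenever `2β·M ≤ A`** for a constant `M ≥ 0` dominating `g(L) = P_{G∖L}(a₂ ↔ b)` on the clusters
`L = C(u) ∋ c` (`KSide.T2oK_nonneg_of_A_ge` is the case `M = hb`). -/
theorem T2oK_nonneg_of_A_ge_M (hp : IsProbVec p) (hM0 : 0 ≤ M)
    (hM : ∀ ω : Config E, c ∈ cluster ends ω u →
      delClusterProb p ends a₂ {W : Set V | b ∈ W} (cluster ends ω u) ≤ M)
    (hA : 2 * (prob p Set.univ * prob p (PDEvent ends u a₂ c) + prob p (avoidAll ends a₂ {c}) * prob p (avoidAll ends a₂ {u})) * M ≤ ((prob p (PDEvent ends u a₂ c) * prob p (connEvent ends a₂ b) + prob p (avoidAll ends a₂ {c}) * gap p ends u a₂ b) + (prob p Set.univ * EQb3 p ends u a₂ c b + prob p Set.univ * PDb p ends u a₂ c b + prob p (connEvent ends a₂ b) * EQ3 p ends u a₂ c + prob p (connEvent ends a₂ b) * prob p (avoidAll ends a₂ {u}) - (prob p Set.univ - prob p (avoidAll ends a₂ {c}))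 * gap p ends u a₂ b))) :
    0 ≤ T2oK p ends o a₂ c b u :=
  KSide.T2oK_nonneg_of_K3 p ends o a₂ c b u hp (K3_nonneg_of_A_ge_M p ends o a₂ c b u M hp hM0 hM hA)

end PhiM

section Guc

variable (p : E → R) (ends : E → Sym2 V) (o a₂ c b u : V)

omit [Fintype V] [DecidableEq V] in
/-- `g(C(u)(ω)) ≤ g({u, c})` whenever `c ∈ C(u)(ω)`: the cluster contains `{u, c}` and `g` is antitone. -/
lemma delClusterProb_cluster_le_guc (hp : IsProbVec p) (ω : Config E) (hc : c ∈ cluster ends ω u) :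
    delClusterProb p ends a₂ {W : Set V | b ∈ W} (cluster ends ω u) ≤
      delClusterProb p ends a₂ {W : Set V | b ∈ W} ({u, c} : Set V) := by
  refine delClusterProb_anti p hp ends a₂ (𝓥 := {W : Set V | b ∈ W}) (fun _ _ h hb => h hb) ?_
  intro x hx
  rcases hx with rfl | hx
  · exact mem_cluster_self ends ω x
  · rw [Set.mem_singleton_iff] at hx
    rw [hx]
    exact hc

/-- **`0 ≤ T2oK` whenever `2β·g({u, c}) ≤ A`** with `g({u, c}) = P_{G − {u, c}}(a₂ ↔ b)` (`delClusterProb` at `{u, c}`;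
`g({u, c}) ≤ hb`, so this contains the class of `KSide.T2oK_nonneg_of_A_ge`). -/
theorem T2oK_nonneg_of_A_ge_guc (hp : IsProbVec p)
    (hA : 2 * (prob p Set.univ * prob p (PDEvent ends u a₂ c) + prob p (avoidAll ends a₂ {c}) * prob p (avoidAll ends a₂ {u})) * delClusterProb p ends a₂ {W : Set V | b ∈ W} ({u, c} : Set V) ≤ ((prob p (PDEvent ends u a₂ c) * prob p (connEvent ends a₂ b) + prob p (avoidAll ends a₂ {c}) * gap p ends u a₂ b) + (prob p Set.univ * EQb3 p ends u a₂ c b + prob p Set.univ * PDb p ends u a₂ c b + prob p (connEvent ends a₂ b) * EQ3 p ends u a₂ c + prob p (connEvent ends a₂ b) * prob p (avoidAll ends a₂ {u}) - (prob p Set.univ - prob p (avoidAll ends a₂ {c})) * gap p ends u a₂ b))) :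
    0 ≤ T2oK p ends o a₂ c b u :=
  T2oK_nonneg_of_A_ge_M p ends o a₂ c b u _ hp (delClusterProb_nonneg p hp ends a₂ _ _)
    (fun ω hc => delClusterProb_cluster_le_guc p ends a₂ c b u hp ω hc) hA

end Guc

end KSup

end RootLeafU

end Summit.Ventures.PercRepro2
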